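import Summits.QuantumFields.YangMills.Theorems.UnitScaleTiltHalvingStepOfPillarsRoom
import HarnessLib

/-!
# Route `UnitScaleTilt`, crux K1 child «MinimiserStabilityRegPr» (stmt-QuantumFields-19200), registered stub V2′ `stub_halvingStep` (v8∕v10 `BirthV10`) —
# **THE DOOR v3 IN STATIONARITY CURRENCY, FILE 1∕2 (★★OWNER RULING №30 (4)(a), LEAD-H RULING L-7 (a)): THE ROOM HALVING FOR STATIONARY CONFIGURATIONS FROM THREE
# DISPLAYED TEXTS** — as ✓`HalvingStepOfPillarsRoom.roomHalving_of_rows` (door v2 FILE 1) with the minimiser premise `IsMinOn wilsonAction4 (regFibrePr …) U` REPLACED,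
# both in the C_E binder (`hCEstat`) and in the conclusion, by LEAD-H L-7 (a)'s FIRST-ORDER clause: stationarity of the Wilson action along every bondwise-differentiable
# curve in the exact (0.4)-fibre through `U`

Cell `ym3-torus` (HUMAN RULING D-0037, YM ladder rung R3 — continuum SU(2) YM₃ on the torus is a RUNG, not the Clay problem), width seat `ym-ust-19200-w3` gen 5.
`--supports stmt-QuantumFields-19200 --as helper`; def-free, 0 sorry, standard axioms.  The three texts are HYPOTHESES; nothing here claims the stub, the crux, the rung
or the mass gap.

WHY (★★OWNER №29 (B) ∕ №30 (4), LEAD-H L-4 addendum (B) + L-7).  The residual «H-SMALL» (members below the door's floor `N`) is to be closed by the cover lift (b7):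
lift the datum of a member without room to its own `L^{jc}`-fold cover (a member WITH room), apply the with-room door there, descend `InU` by locality.  The carrier's
`IsCritical` is MINIMALITY (✓`T3Thm1Carrier.varProblem3` :109–110), which does not lift; first variations do (★w3-20520 g5's COVERLIFT-LOCATE, ✓`sum_pullback_mul_eq_sum_mul_pushBond`).
So the door of record for the lift is the STRONGER door whose premise on `U` is STATIONARITY:
`Stat F n K V U := ∀ γ : ℝ → GaugeField (F.P K) 0 SU(2), γ 0 = U → (∀ t, γ t ∈ fibre F ℰp n K _ V) → (∀ b, DifferentiableAt ℝ (t ↦ ↑(γ t b)) 0) → deriv (t ↦ 𝒲(γ t)) 0 = 0`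
(LEAD-H L-7 (a), = the EX knit ✓`Prop7StubEXOfChartPiecesTwSL` :179–182 clause; `IsCritical ⇒ Stat` is ✓`Prop7CritEL.deriv_comp_eq_zero_of_isCritR2`).  On the door side
the minimiser premise is consumed at exactly ONE place — it is forwarded to the C_E binder (print's (H) uses `U_k` through the E–L system (141)–(144), FILE A
✓`tracePairing_of_isMinOn_localChart` = Fermat along lines) — so the swap is literal: `hCEstat` asks its rows for every STATIONARY `U ∈ regFibrePr F n K _ ε₀ V` (supplier:
L4-Stat = ★w7-19200 g1's L4 + B5 «differentiable gauge fix» + FILE A twin `tracePairing_of_derivZero_localChart`, LEAD-H L-7 (b)).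

WHAT THIS FILE PROVES (no definition, no sorry):
* §5 ★★ **`roomHalvingStat_of_rows (hP2) (hP1room) (hCEstat)`** : `∀ L, 1 < L → ∃ (N : ℕ) (B₃ a₅ : ℝ), 4 < B₃ ∧ 0 < a₅ ∧ ∀ F, F.L = L → ∀ n K (hnK : n < K),
  N ≤ F.L ^ (F.m + n) → ∀ ε₀ ε₁, 0 < ε₁ → 0 < ε₀ → ε₀ ≤ a₅ → ∀ V, PlaqSmall ε₁ V → ∀ U ∈ regFibrePr F n K _ ε₀ V, Stat F n K V U → RegPr F n K (max (B₃ε₁) (ε₀∕2)) U` —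
  proof = door v2 FILE 1 §2 verbatim (constants `N := max (2ρ + Nr) Nce`, `B₃ := 4C′B₀B₃ᴾ²`, `a₅ := exists_a5 (K₁+K₂+1) a`; per member ✓`regPrHalving_of_memberCharts`,
  `hP1room → (u, A) → hCEstat → ✓sitePackage_of_rows → P2 at cubeSeqMT3 → ✓siteClause_of_pieces_int`).  `hP2`, `hP1room` are door v2's VERBATIM (✓p628950).
FILE 2∕2 (`…HalvingStepOfPillarsRoomStatDoor`) turns §5 into `RoomHalvingTextStat L` (L-7 (a) verbatim) and records `RoomHalvingTextStat ⇒ RoomHalvingText` (the glue (1)).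
HONEST SCOPE.  Assembly only; H debt BY NAME after door v3: hP2 ✓p625735 · hP1room ⇐ J-N05♭ `core′` + ✓p628195 · hCEstat ⇐ L4-Stat · H-SMALL ⇐ `stub_of_roomHalvingStat`
(★w3-20520 g5 FILE 1–3).  NOT a claim about the stub, the crux, the rung or the mass gap.

References: T. Bałaban, CMP **102** (1985) 277–309 [Balaban1985Variational] (111) p.294, (141)–(144) p.300, (152)–(168) pp.301–304, Prop. 8 p.304; CMP **99** (1985)
75–102 [Balaban1985RegularSpaces] Thm 2 p.83, (1.140) p.100.
-/

set_option autoImplicit false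

noncomputable section

open scoped BigOperators Matrix.Norms.L2Operator

namespace Summit.QuantumFields.YangMills.Theorems.HalvingStepOfPillarsRoomStat

open Literature.MathematicalPhysics.QuantumFieldTheory.Balaban1983to89
open Literature.MathematicalPhysics.QuantumFieldTheory.Balaban1983to89.T3ContinuumYM3Torus
open Literature.MathematicalPhysics.QuantumFieldTheory.Balaban1983to89.T3PrintedRegularMinimiser
open Literature.MathematicalPhysics.QuantumFieldTheory.Balaban1983to89.T3PrintedMinimiserExistence
open Literature.MathematicalPhysics.QuantumFieldTheory.Balaban1983to89.T3Thm1Carrier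
open Literature.MathematicalPhysics.QuantumFieldTheory.Balaban1983to89.T3Thm1CarrierNative (IsCritR2)
open Literature.MathematicalPhysics.QuantumFieldTheory.Balaban1983to89.T3UnitLawDensityEML (ℰp)
open Literature.MathematicalPhysics.QuantumFieldTheory.Balaban1983to89.T3ConstrainedMinimiser (fibre)
open Complex (I)
open B5Eq117TorusCarriers (Mk)
open B5Eq118OneStroke (iterBlockOf)
open B5Prop12FieldsLattice (distSite distSite_self)
open B6SectADomainsV1 (Domains)
open B6SectAOperatorsV1 (BondIdx SiteIdx)
open B7Prop1Explicit (expUnit)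
open B7Eq92Concrete (mgauge)
open B8Ineq132 (BondTouches)
open B8Eq140Level (SideTouches sideTouches_mono Cond140)
open B8Eq143PlaqExpansion (pdiv)
open B8Eq146AExpansion (plaqCovDeriv)
open B8Eq184Proof (cfgExp)
open B8Thm2SetupTorus (cfgPull gaugePull pullDom)
open B10Eq27TorusAxialLog (pull unitsField toUField transl)
open B11Eq115Space (levOf)
open LatticeFieldCalculus (bondAvgIter laplace diverg siteAvgIter)
open FlatCubeOpsText (Adm22 IsLevWeight FlatOpsAdmAtMS)
open FlatCubeSequenceAligned (cubeSeqMT3)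
open FlatCubeSequenceAdm (adm22_cubeSeqMT3)
open FlatOpsLettersAssembly (flatH isFlatH_flatH)
open HalvingQuarterCubeSeq (inOm_top_of_dist)
open HalvingP1FlatPillar (DP1Clause P1FlatPillarAt P1FlatPillar)
open HalvingP1FlatPillarPrime (P1FlatPillarAt' P1FlatPillar' sideTouches_subset_cube0)
open HalvingStepOfPillars (layerChart_of_memberChart)
open HalvingAssemblyInterior (siteClause_of_pieces_int)
open HalvingStepOfPillarsRoom (regPrHalving_of_memberCharts)
open FlatCubeSequenceAligned (cubeSetM)
open HalvingSitePackage (sitePackage_of_rows)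
open Summit.QuantumFields.YangMills.Theorems.Prop8ChartDoubleBar (chartLogFlat)

/-! ## §5 The room halving in stationarity currency from the three displayed texts -/

section Door

/-- ★★ **THE ROOM HALVING, STATIONARITY CURRENCY, FROM THE THREE DISPLAYED TEXTS** (★★OWNER №30 (4)(a), LEAD-H L-7 (a)): as ✓`HalvingStepOfPillarsRoom.roomHalving_of_rows` with
the minimiser premise `IsMinOn wilsonAction4 (regFibrePr F n K _ ε₀ V) U` replaced — in the C_E binder `hCEstat` AND in the conclusion — by stationarity of the Wilson action
along every bondwise-differentiable curve in the exact (0.4)-fibre through `U`.  Even `L`: vacuous.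
[cite: Balaban1985Variational, (111) p.294, (144) p.300, (152)-(168) pp.301-304, Prop. 8 p.304; Balaban1985RegularSpaces, Thm 2 p.83, (1.140) p.100] -/
theorem roomHalvingStat_of_rows
    (hP2 : ∀ L : ℕ, Odd L → 1 < L → ∃ (R₀ M₀ : ℕ) (B₀ δ₀ B₃ : ℝ), 0 < B₀ ∧ 0 < δ₀ ∧ 0 < B₃ ∧ FlatOpsAdmAtMS L R₀ M₀ B₀ δ₀ B₃)
    (hP1room : ∀ L : ℕ, Odd L → 1 < L → ∃ (Mₚ Rₚ : ℕ), ∀ (R M aₑ S : ℕ) (hM : 1 ≤ M), M = L ^ aₑ → Mₚ ≤ M → Rₚ ≤ R → R * M ≤ S →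
      ∃ B₁ : ℝ, 0 ≤ B₁ ∧ ∃ Nr : ℕ,
      ∀ (ρ : ℕ) (a Cr : ℝ), 0 < Cr → 12 * ((ρ : ℝ) + (M : ℝ)) * a ≤ Cr →
        16 * 3800 * ((5 * L : ℕ) : ℝ) ^ 2 * (L : ℝ) * ((B₁ + 1) * a) ≤ 1 →
        ∀ F : T3Family, F.L = L → ∀ (n K : ℕ) (hnK : n < K), 2 * ρ + Nr ≤ F.L ^ (F.m + n) →
          ∀ (ε₀ ε₁ : ℝ), 0 < ε₁ → 0 < ε₀ → ε₀ ≤ a → Cr * ε₁ ≤ ε₀ →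
          ∀ V : GaugeField (F.P n) 0 (Matrix.specialUnitaryGroup (Fin 2) ℂ), PlaqSmall ε₁ V →
            ∀ U ∈ regFibrePr F n K hnK.le ε₀ V, ∀ x : Site (F.P K) 0,
              P1FlatPillarAt' F n K (cubeSeqMT3 F n K x ρ S M hM) (cubeSetM x (K - n) ρ S M 0) x ε₀ ε₁ B₁ 6 (8 * (L : ℝ) * (B₁ + 1)) U)
    (hCEstat : ∀ L : ℕ, Odd L → 1 < L → ∀ (R₀ M₀ : ℕ) (B₀ δ₀ B₃ : ℝ), 0 < B₀ → 0 < δ₀ → 0 < B₃ → FlatOpsAdmAtMS L R₀ M₀ B₀ δ₀ B₃ →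
      ∃ (M₁ R₁ : ℕ), ∀ (R M aₑ S : ℕ) (hM : 1 ≤ M), M = L ^ aₑ → M₁ ≤ M → M₀ ≤ M → R₁ ≤ R → R₀ ≤ R → R * M ≤ S →
      ∀ B₁ : ℝ, 0 ≤ B₁ →
      ∃ (Nce : ℕ) (K₁ K₂ C₂ Cce aCE : ℝ), 0 ≤ K₁ ∧ 0 ≤ K₂ ∧ 0 ≤ C₂ ∧ 0 ≤ Cce ∧ 0 < aCE ∧
      ∀ ρ : ℕ, 1 ≤ ρ → ∀ F : T3Family, F.L = L → ∀ (n K : ℕ) (hnK : n < K), Nce ≤ F.L ^ (F.m + n) →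
        ∀ (ε₀ ε₁ : ℝ), 0 < ε₁ → 0 < ε₀ → ε₀ ≤ aCE → Cce * ε₁ ≤ ε₀ →
        ∀ V : GaugeField (F.P n) 0 (Matrix.specialUnitaryGroup (Fin 2) ℂ), PlaqSmall ε₁ V →
          ∀ U ∈ regFibrePr F n K hnK.le ε₀ V,
            (∀ γ : ℝ → GaugeField (F.P K) 0 (Matrix.specialUnitaryGroup (Fin 2) ℂ), γ 0 = U → (∀ t, γ t ∈ fibre F ℰp n K hnK.le V) →
              (∀ b, DifferentiableAt ℝ (fun t => ((γ t b : Matrix.specialUnitaryGroup (Fin 2) ℂ) : Matrix (Fin 2) (Fin 2) ℂ)) 0) →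
                deriv (fun t => wilsonAction4 (γ t)) 0 = 0) →
            ∀ (x : Site (F.P K) 0) (C₂' : ℝ) (u : GaugeTransf (F.P K) 0 (Matrix.unitaryGroup (Fin 2) ℂ)) (A : PBond (F.P K) 0 → Matrix (Fin 2) (Fin 2) ℂ),
              -- the seven conjuncts of `P1FlatPillarAt' F n K (cubeSeqMT3 …) (cubeSetM x (K−n) ρ S M 0) x ε₀ ε₁ B₁ 6 C₂' U` for THIS pair `(u, A)` ((ii′) on `□₀`)
              DP1Clause F n K (cubeSeqMT3 F n K x ρ S M hM) x U u →
              (∀ b : PBond (F.P K) 0, IsSelfAdjoint (A b)) → (∀ b : PBond (F.P K) 0, Matrix.trace (A b) = 0) →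
              (∀ (z : B7Prop1Explicit.Site (F.P K).d) (μ : Fin (F.P K).d),
                transl (0 : Site (F.P K) 0) z ∈ cubeSetM x (K - n) ρ S M 0 → (transl (0 : Site (F.P K) 0) z).shift μ ∈ cubeSetM x (K - n) ρ S M 0 →
                (Unitary.toUnits (u (transl 0 z)))⁻¹ * unitsField (toUField U) ⟨transl 0 z, μ⟩ * Unitary.toUnits (u ((transl 0 z).shift μ)) =
                  expUnit (I • ((((F.L : ℝ)⁻¹) ^ (K - n)) • A ⟨transl 0 z, μ⟩))) →
              (∀ w : ℕ → PBond (F.P K) 0 → ℝ, IsLevWeight F n K (cubeSeqMT3 F n K x ρ S M hM) w →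
                (∀ b : PBond (F.P K) 0, w 1 b * ‖A b‖ ≤ B₁ * ε₀) ∧
                (∀ (b : PBond (F.P K) 0) (ν : Fin (F.P K).d), w 2 b * (F.L : ℝ) ^ (K - n) * ‖A ⟨b.src.shift ν, b.dir⟩ - A b‖ ≤ B₁ * ε₀)) →
              (∃ μ : SiteIdx (cubeSeqMT3 F n K x ρ S M hM) → Matrix (Fin 2) (Fin 2) ℂ, ∀ s : Site (F.P K) 0,
                laplace ((F.L : ℝ) ^ (K - n)) (diverg ((F.L : ℝ) ^ (K - n)) A) s =
                  ∑ i : SiteIdx (cubeSeqMT3 F n K x ρ S M hM), siteAvgIter (i.1.1 : ℕ) (Pi.single s (1 : ℝ)) i.1.2 • μ i) →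
              (∀ c : BondIdx (cubeSeqMT3 F n K x ρ S M hM), (c.1.1 : ℕ) = K - n →
                c.1.2.src ∈ (cubeSeqMT3 F n K x ρ S M hM).Om (c.1.1 : ℕ) → c.1.2.tgt ∈ (cubeSeqMT3 F n K x ρ S M hM).Om (c.1.1 : ℕ) →
                ‖chartLogFlat (((F.L : ℝ)⁻¹) ^ (K - n)) (cubeSeqMT3 F n K x ρ S M hM) A c‖ ≤
                  6 * ε₁ * (distSite (Mk (F.P K) (c.1.1 : ℕ)) c.1.2.src (iterBlockOf (c.1.1 : ℕ) x) + 1)) →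
              (∀ c : BondIdx (cubeSeqMT3 F n K x ρ S M hM), ‖chartLogFlat (((F.L : ℝ)⁻¹) ^ (K - n)) (cubeSeqMT3 F n K x ρ S M hM) A c‖ ≤ C₂' * ε₀) →
              -- OUTPUT: `sitePackage_of_rows`'s rows for some `Hs`, `C`, `e₁`, `e₃`
              ∃ (Hs : (BondIdx (cubeSeqMT3 F n K x ρ S M hM) → Matrix (Fin 2) (Fin 2) ℂ) → (PBond (F.P K) 0 → Matrix (Fin 2) (Fin 2) ℂ))
                (C : (PBond (F.P K) 0 → Matrix (Fin 2) (Fin 2) ℂ) → (BondIdx (cubeSeqMT3 F n K x ρ S M hM) → Matrix (Fin 2) (Fin 2) ℂ))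
                (e₁ e₃ : ℝ),
                ((∀ (z : B7Prop1Explicit.Site (F.P K).d) (τ : Fin (F.P K).d),
                    SideTouches (pullDom (fun j => if K - n ≤ j then ({x} : Set (Site (F.P K) 0)) else (∅ : Set (Site (F.P K) 0))) (K - n)) z τ →
                    ‖((A + Hs (C A)) - fun b : PBond (F.P K) 0 => ∑ c, flatH F n K (cubeSeqMT3 F n K x ρ S M hM) (Pi.single c 1) b •
                        bondAvgIter (c.1.1 : ℕ) (A + Hs (C A)) c.1.2) ⟨transl 0 z, τ⟩‖ ≤ e₁) ∧
                  (∀ (z : B7Prop1Explicit.Site (F.P K).d) (κ τ : Fin (F.P K).d),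
                    SideTouches (pullDom (fun j => if K - n ≤ j then ({x} : Set (Site (F.P K) 0)) else (∅ : Set (Site (F.P K) 0))) (K - n)) z τ →
                    ‖(((F.L : ℝ)⁻¹) ^ (K - n))⁻¹ •
                      (((A + Hs (C A)) - fun b : PBond (F.P K) 0 => ∑ c, flatH F n K (cubeSeqMT3 F n K x ρ S M hM) (Pi.single c 1) b •
                          bondAvgIter (c.1.1 : ℕ) (A + Hs (C A)) c.1.2) ⟨(transl 0 z).shift κ, τ⟩ -
                        ((A + Hs (C A)) - fun b : PBond (F.P K) 0 => ∑ c, flatH F n K (cubeSeqMT3 F n K x ρ S M hM) (Pi.single c 1) b •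
                          bondAvgIter (c.1.1 : ℕ) (A + Hs (C A)) c.1.2) ⟨transl 0 z, τ⟩)‖ ≤ e₁) ∧
                  (∀ (z : B7Prop1Explicit.Site (F.P K).d) (μ : Fin (F.P K).d),
                    BondTouches (pullDom (fun j => if K - n ≤ j then ({x} : Set (Site (F.P K) 0)) else (∅ : Set (Site (F.P K) 0))) (K - n)) z μ →
                    ‖pdiv (((F.L : ℝ)⁻¹) ^ (K - n)) (1 : B7Prop1Explicit.Site (F.P K).d → Fin (F.P K).d → (Matrix (Fin 2) (Fin 2) ℂ)ˣ)
                        (plaqCovDeriv (((F.L : ℝ)⁻¹) ^ (K - n)) (1 : B7Prop1Explicit.Site (F.P K).d → Fin (F.P K).d → (Matrix (Fin 2) (Fin 2) ℂ)ˣ)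
                          (pull ((A + Hs (C A)) - fun b : PBond (F.P K) 0 => ∑ c, flatH F n K (cubeSeqMT3 F n K x ρ S M hM) (Pi.single c 1) b •
                            bondAvgIter (c.1.1 : ℕ) (A + Hs (C A)) c.1.2) 0)) μ z‖ ≤ e₁)) ∧
                ((∀ (z : B7Prop1Explicit.Site (F.P K).d) (τ : Fin (F.P K).d),
                    SideTouches (pullDom (fun j => if K - n ≤ j then ({x} : Set (Site (F.P K) 0)) else (∅ : Set (Site (F.P K) 0))) (K - n)) z τ →
                    ‖Hs (C A) ⟨transl 0 z, τ⟩‖ ≤ e₃) ∧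
                  (∀ (z : B7Prop1Explicit.Site (F.P K).d) (κ τ : Fin (F.P K).d),
                    SideTouches (pullDom (fun j => if K - n ≤ j then ({x} : Set (Site (F.P K) 0)) else (∅ : Set (Site (F.P K) 0))) (K - n)) z τ →
                    ‖(((F.L : ℝ)⁻¹) ^ (K - n))⁻¹ • (Hs (C A) ⟨(transl 0 z).shift κ, τ⟩ - Hs (C A) ⟨transl 0 z, τ⟩)‖ ≤ e₃) ∧
                  (∀ (z : B7Prop1Explicit.Site (F.P K).d) (μ : Fin (F.P K).d),
                    BondTouches (pullDom (fun j => if K - n ≤ j then ({x} : Set (Site (F.P K) 0)) else (∅ : Set (Site (F.P K) 0))) (K - n)) z μ →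
                    ‖pdiv (((F.L : ℝ)⁻¹) ^ (K - n)) (1 : B7Prop1Explicit.Site (F.P K).d → Fin (F.P K).d → (Matrix (Fin 2) (Fin 2) ℂ)ˣ)
                        (plaqCovDeriv (((F.L : ℝ)⁻¹) ^ (K - n)) (1 : B7Prop1Explicit.Site (F.P K).d → Fin (F.P K).d → (Matrix (Fin 2) (Fin 2) ℂ)ˣ)
                          (pull (Hs (C A)) 0)) μ z‖ ≤ e₃)) ∧
                (∀ c : BondIdx (cubeSeqMT3 F n K x ρ S M hM), (c.1.1 : ℕ) = K - n →
                  c.1.2.src ∈ (cubeSeqMT3 F n K x ρ S M hM).Om (c.1.1 : ℕ) → c.1.2.tgt ∈ (cubeSeqMT3 F n K x ρ S M hM).Om (c.1.1 : ℕ) →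
                  ‖bondAvgIter (c.1.1 : ℕ) (A + Hs (C A)) c.1.2‖ ≤ 6 * ε₁ * (distSite (Mk (F.P K) (c.1.1 : ℕ)) c.1.2.src (iterBlockOf (c.1.1 : ℕ) x) + 1)) ∧
                (∀ c : BondIdx (cubeSeqMT3 F n K x ρ S M hM),
                  ¬ ((c.1.1 : ℕ) = K - n ∧ c.1.2.src ∈ (cubeSeqMT3 F n K x ρ S M hM).Om (c.1.1 : ℕ) ∧
                      c.1.2.tgt ∈ (cubeSeqMT3 F n K x ρ S M hM).Om (c.1.1 : ℕ)) →
                  ‖bondAvgIter (c.1.1 : ℕ) (A + Hs (C A)) c.1.2‖ ≤ C₂ * ε₀ * (F.L : ℝ) ^ ((K - n) - (c.1.1 : ℕ))) ∧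
                e₁ ≤ K₁ * ε₀ ^ 2 ∧ e₃ ≤ K₂ * ε₀ ^ 2) :
    ∀ L : ℕ, 1 < L → ∃ (N : ℕ) (B₃ a₅ : ℝ), 4 < B₃ ∧ 0 < a₅ ∧
      ∀ F : T3Family, F.L = L → ∀ (n K : ℕ) (hnK : n < K), N ≤ F.L ^ (F.m + n) →
        ∀ (ε₀ ε₁ : ℝ), 0 < ε₁ → 0 < ε₀ → ε₀ ≤ a₅ →
          ∀ V : GaugeField (F.P n) 0 (Matrix.specialUnitaryGroup (Fin 2) ℂ), PlaqSmall ε₁ V →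
            ∀ U ∈ regFibrePr F n K hnK.le ε₀ V,
              (∀ γ : ℝ → GaugeField (F.P K) 0 (Matrix.specialUnitaryGroup (Fin 2) ℂ), γ 0 = U → (∀ t, γ t ∈ fibre F ℰp n K hnK.le V) →
                (∀ b, DifferentiableAt ℝ (fun t => ((γ t b : Matrix.specialUnitaryGroup (Fin 2) ℂ) : Matrix (Fin 2) (Fin 2) ℂ)) 0) →
                  deriv (fun t => wilsonAction4 (γ t)) 0 = 0) →
                RegPr F n K (max (B₃ * ε₁) (ε₀ / 2)) U := by
  intro L hL
  by_cases hodd : Odd L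
  swap
  · -- even `L`: no member, the minimiser form is vacuous
    exact ⟨0, 5, 1, by norm_num, one_pos, fun F hF => absurd (hF ▸ F.hL.1) hodd⟩
  -- the P2 text and its constants
  obtain ⟨R₀, M₀, B₀, δ₀, B₃, hB₀, hδ₀, hB₃, hP2L⟩ := hP2 L hodd hL
  -- the C_E thresholds
  obtain ⟨M₁, R₁, hCE₁⟩ := hCEstat L hodd hL R₀ M₀ B₀ δ₀ B₃ hB₀ hδ₀ hB₃ hP2L
  -- the P1♭ supplier's floors
  obtain ⟨Mₚ, Rₚ, hP1₁⟩ := hP1room L hodd hL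
  -- the geometry of the cube sequence: `M = L^{aₑ} ≥ max (max M₁ M₀) Mₚ`, `R = max (max R₁ R₀) (max 1 Rₚ)`, `S = R·M`
  set aₑ : ℕ := max (max M₁ M₀) Mₚ with haₑ
  set M : ℕ := L ^ aₑ with hMdef
  have hL2 : 2 ≤ L := hL
  have hpow : aₑ ≤ L ^ aₑ := (Nat.lt_pow_self (by omega)).le
  have hM₁M : M₁ ≤ M := ((le_max_left _ _).trans (le_max_left _ _)).trans hpow
  have hM₀M : M₀ ≤ M := ((le_max_right _ _).trans (le_max_left _ _)).trans hpow
  have hMₚM : Mₚ ≤ M := (le_max_right _ _).trans hpow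
  have hM1 : 1 ≤ M := Nat.one_le_pow _ _ (by omega)
  set R : ℕ := max (max R₁ R₀) (max 1 Rₚ) with hRdef
  have hR1 : 1 ≤ R := (le_max_left _ _).trans (le_max_right _ _)
  have hRₚR : Rₚ ≤ R := (le_max_right _ _).trans (le_max_right _ _)
  set S : ℕ := R * M with hSdef
  -- P1♭'s size constant and room letter (ρ-free)
  obtain ⟨B₁, hB₁, Nr, hP1L⟩ := hP1₁ R M aₑ S hM1 rfl hMₚM hRₚR le_rfl
  -- the C_E floor letter and constants (ρ-free)
  obtain ⟨Nce, K₁, K₂, C₂, Cce, aCE, hK₁, hK₂, hC₂, hCce, haCE, hCE₂⟩ :=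
    hCE₁ R M aₑ S hM1 rfl hM₁M hM₀M ((le_max_left _ _).trans (le_max_left _ _)) ((le_max_right _ _).trans (le_max_left _ _)) le_rfl B₁ hB₁
  -- the package constant `C′` and the inner radius `ρ` by (163)
  have hBB : 0 < B₀ * B₃ := mul_pos hB₀ hB₃
  set C' : ℝ := max (max 12 C₂) ((Cce + 2) / (B₀ * B₃)) with hC'def
  have hC'12 : (12 : ℝ) ≤ C' := (le_max_left _ _).trans (le_max_left _ _)
  have hC'C₂ : C₂ ≤ C' := (le_max_right _ _).trans (le_max_left _ _)
  have hC'ce : (Cce + 2) / (B₀ * B₃) ≤ C' := le_max_right _ _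
  have hC'0 : 0 ≤ C' := by linarith
  have hCBB : Cce + 2 ≤ C' * (B₀ * B₃) := by
    have := (div_le_iff₀ hBB).1 hC'ce
    linarith
  have hT0 : 0 ≤ 4 * C' * B₀ * B₃ := by positivity
  obtain ⟨ρ, hρ2, h163⟩ := HalvingAssembly.exists_rho_163 hδ₀ hT0
  have hρ1 : 1 ≤ ρ := by
    have : (1 : ℝ) ≤ (ρ : ℝ) := by linarith
    exact_mod_cast this
  -- the ratio `Cr = 4C′B₀B₃` and the ceiling `a` (after `ρ`)
  set Cr : ℝ := 4 * C' * B₀ * B₃ with hCrdef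
  have hCBB2 : (2 : ℝ) ≤ C' * (B₀ * B₃) := by linarith
  have hCr4ring : (4 : ℝ) * C' * B₀ * B₃ = 4 * (C' * (B₀ * B₃)) := by ring
  have hCr8 : (8 : ℝ) ≤ Cr := by rw [hCrdef, hCr4ring]; linarith
  have hCceCr : Cce ≤ Cr := by rw [hCrdef, hCr4ring]; linarith
  have hCr : 0 < Cr := by linarith
  have hρM : 0 < 12 * ((ρ : ℝ) + (M : ℝ)) := by positivity
  have hden : 0 < 16 * 3800 * ((5 * L : ℕ) : ℝ) ^ 2 * (L : ℝ) * (B₁ + 1) := by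
    have : (0 : ℝ) < L := by exact_mod_cast (by omega : 0 < L)
    have : (0 : ℝ) < ((5 * L : ℕ) : ℝ) := by positivity
    positivity
  set a : ℝ := min aCE (min (Cr / (12 * ((ρ : ℝ) + (M : ℝ)))) (1 / (16 * 3800 * ((5 * L : ℕ) : ℝ) ^ 2 * (L : ℝ) * (B₁ + 1))))
    with hadef
  have ha : 0 < a := lt_min haCE (lt_min (div_pos hCr hρM) (div_pos one_pos hden))
  have haCE' : a ≤ aCE := min_le_left _ _
  have hreg₁ : 12 * ((ρ : ℝ) + (M : ℝ)) * a ≤ Cr := by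
    have h1 : a ≤ Cr / (12 * ((ρ : ℝ) + (M : ℝ))) := (min_le_right _ _).trans (min_le_left _ _)
    have := (le_div_iff₀ hρM).1 h1
    linarith
  have hreg₀ : 16 * 3800 * ((5 * L : ℕ) : ℝ) ^ 2 * (L : ℝ) * ((B₁ + 1) * a) ≤ 1 := by
    have h1 : a ≤ 1 / (16 * 3800 * ((5 * L : ℕ) : ℝ) ^ 2 * (L : ℝ) * (B₁ + 1)) := (min_le_right _ _).trans (min_le_right _ _)
    have := (le_div_iff₀ hden).1 h1
    linarith
  -- P1♭ at these constants, at the members with room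
  have hP1' := hP1L ρ a Cr hCr hreg₁ hreg₀
  -- the stub's constants: `B₃ := Cr`, `a₅ := exists_a5 (K₁ + K₂ + 1) a`, floor `N := max (2ρ + Nr) Nce`
  have hKc : (0 : ℝ) ≤ K₁ + K₂ + 1 := by positivity
  obtain ⟨a₅, ha₅, ha₅a, ha₅90, hKa⟩ := Prop8LastMile.exists_a5 hKc ha
  have hCr4 : 4 < Cr := by linarith
  refine ⟨max (2 * ρ + Nr) Nce, Cr, a₅, hCr4, ha₅, ?_⟩
  have hR₀R : R₀ ≤ R := (le_max_right R₁ R₀).trans (le_max_left _ _)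
  have hS1 : 1 ≤ S := by
    show 1 ≤ R * M
    exact Nat.one_le_iff_ne_zero.mpr (Nat.mul_ne_zero (by omega) (by omega))
  have hRS : R * M ≤ S := le_rfl
  intro F hF n K hnK hN ε₀ ε₁ hε₁ hε₀ hε₀a₅ V hV U hU hstat
  have hNr : 2 * ρ + Nr ≤ F.L ^ (F.m + n) := (le_max_left _ _).trans hN
  have hNce : Nce ≤ F.L ^ (F.m + n) := (le_max_right _ _).trans hN
  have hUreg : RegPr F n K ε₀ U := ((mem_regFibrePr_iff F).mp hU).2
  have hε₀a : ε₀ ≤ a := hε₀a₅.trans ha₅a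
  -- P1♭ → (u, A) → hCEstat → the package → P2 at the cube sequence → the (167)-chart at every site → §1
  refine regPrHalving_of_memberCharts (Kc := K₁ + K₂ + 1) hCr hKc ha₅90 hKa hε₁ hε₀ hε₀a₅ U hUreg fun hreg x => ?_
  -- P1♭ at the member and the site
  obtain ⟨u, A, ho, hsa, htr, hii, hiii, hiv, hvi, hvii⟩ := hP1' F hF n K hnK hNr ε₀ ε₁ hε₁ hε₀ hε₀a hreg.le V hV U hU x
  have hii_mem : ∀ j, 1 ≤ j → j ≤ K - n → ∀ (z : B7Prop1Explicit.Site (F.P K).d) (μ : Fin (F.P K).d),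
      SideTouches (pullDom (fun i => {y : Site (F.P K) 0 | (cubeSeqMT3 F n K x ρ S M hM1).InOm i y}) j) z μ →
      (Unitary.toUnits (u (transl 0 z)))⁻¹ * unitsField (toUField U) ⟨transl 0 z, μ⟩ * Unitary.toUnits (u ((transl 0 z).shift μ)) =
        expUnit (I • ((((F.L : ℝ)⁻¹) ^ (K - n)) • A ⟨transl 0 z, μ⟩)) :=
    fun j h1 hjk z μ hz => hii z μ (sideTouches_subset_cube0 x ρ S M hM1 hS1 j h1 hjk z μ hz).1
      (sideTouches_subset_cube0 x ρ S M hM1 hS1 j h1 hjk z μ hz).2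
  -- the C_E rows
  have hCceε : Cce * ε₁ ≤ ε₀ := (mul_le_mul_of_nonneg_right hCceCr hε₁.le).trans hreg.le
  obtain ⟨Hs, C, e₁, e₃, h165, h157, hnear, hfar, he₁, he₃⟩ :=
    hCE₂ ρ hρ1 F hF n K hnK hNce ε₀ ε₁ hε₁ hε₀ (hε₀a.trans haCE') hCceε V hV U hU hstat x _ u A ho hsa htr hii hiii hiv hvi hvii
  -- the package at the site
  obtain ⟨u', A', A₁, Rm, B, hA, hchart, hdec, hnear', hfar', s₁, g₁, d₁, s₃, g₃, d₃⟩ :=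
    sitePackage_of_rows x ρ S M hM1 U u A Hs C hsa (layerChart_of_memberChart hnK x ρ S M hM1 hii_mem) h165 h157 hnear hfar he₁ he₃
  -- P2 at the cube sequence centred at `x`, with the canonical level weights
  have hAdm : Adm22 (cubeSeqMT3 F n K x ρ S M hM1) R M := adm22_cubeSeqMT3 F n K x ρ hM1 hRS
  have hw : IsLevWeight F n K (cubeSeqMT3 F n K x ρ S M hM1)
      (fun m b => ((F.L : ℝ) ^ levOf (fun j => {y : Site (F.P K) 0 | (cubeSeqMT3 F n K x ρ S M hM1).InOm j y}) (K - n) b.src *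
        ((F.L : ℝ)⁻¹) ^ (K - n)) ^ m) := fun _ _ => rfl
  obtain ⟨H, Gt, hFH, -, -, -, -, dBI, hdom, h162, hHd⟩ :=
    hP2L F hF n K hnK R M hR₀R hM₀M ⟨aₑ, hMdef⟩ (cubeSeqMT3 F n K x ρ S M hM1) rfl hAdm _ hw
  -- the text's `H` IS the canonical `flatH`
  have hHeq : H = flatH F n K (cubeSeqMT3 F n K x ρ S M hM1) :=
    LinearMap.ext fun X => funext fun b =>
      (hFH X b).trans (isFlatH_flatH (F := F) (n := n) (K := K) (D := cubeSeqMT3 F n K x ρ S M hM1) X b).symm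
  rw [hHeq] at hHd
  -- the per-site clause of the (167)-chart schema
  have hε₀2 : 0 < ε₀ ^ 2 := by positivity
  have hρR : (0 : ℝ) ≤ (ρ : ℝ) - 2 := by linarith
  have h163' : 4 * C' * B₀ * B₃ * Real.exp (-(δ₀ / 2 * ((ρ : ℝ) - 2))) ≤ 1 / 2 := h163
  have hα₂ : K₁ * ε₀ ^ 2 + 1 / 4 * max (4 * C' * B₀ * B₃ * ε₁) (ε₀ / 2) + K₂ * ε₀ ^ 2 <
      1 / 4 * max (Cr * ε₁) (ε₀ / 2) + (K₁ + K₂ + 1) * ε₀ ^ 2 := by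
    rw [hCrdef]; linarith
  exact siteClause_of_pieces_int hnK x ρ S M hM1 hw hdom hHd h162 hδ₀.le hB₀.le hB₃.le (C₁ := 6) (C := C') (by norm_num) (by linarith) hC'C₂
    hε₁.le hε₀.le hρR h163' le_rfl hα₂ U u' hA hchart (fun _ => rfl) hdec hnear' hfar' s₁ g₁ d₁ s₃ g₃ d₃

end Door

end Summit.QuantumFields.YangMills.Theorems.HalvingStepOfPillarsRoomStat

end
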